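import Literature.AlgebraicGeometry.Motives.DeRhamComparisonFrolicherProofs
import Literature.NumberTheory.Transcendental.DolbeaultIntegrabilityProofs
import HarnessLib

/-!
# The Frölicher inequality from Cartan–Serre finiteness alone

`Literature/AlgebraicGeometry/Motives/DeRhamComparisonFrolicherProofs.lean` proves the analytic
core of the Frölicher inequality,
`Literature.AlgebraicGeometry.Motives.finrank_complexDeRham_le_sum_hodgeNumber`
(`dim_ℂ H^k_dR(M; ℂ) ≤ ∑_{p+q=k} h^{p,q}(M)` for a compact Hausdorff complex manifold;
Voisin (2002), §8.3.3, proof of Thm. 8.28 and Rem. 8.29, pp. 204–205), conditionally on ten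
named facts: nine facts of the type calculus of complex forms (`inChart_mextDeriv`,
`mextDeriv_smul_complex`, `isSmoothForm_typeComponent`, `sum_antidiagonal_typeComponent`,
`typeComponent_typeComponent`, `isOfType_iff_typeComponent_eq_self`,
`mextDeriv_eq_dolbeault_add_dolbeaultBar`, `IsOfType.dolbeault_eq`, `IsOfType.dolbeaultBar_eq`)
and Cartan–Serre finiteness `finite_dolbeaultCohomology`.

All nine type-calculus facts are now **discharged** — `inChart_mextDeriv_holds`
(`Geometry/Kaehler/ManifoldFormsChart`), `mextDeriv_smul_complex_holds`,
`sum_antidiagonal_typeComponent_holds`, `typeComponent_typeComponent_holds`,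
`isOfType_iff_typeComponent_eq_self_holds` (`ComplexFormsProofs`),
`isSmoothForm_typeComponent_holds` (`ComplexFormsSmoothProofs`),
`mextDeriv_eq_dolbeault_add_dolbeaultBar_holds` (`DolbeaultIntegrabilityProofs`: `d = ∂ + ∂̄`),
`IsOfType.dolbeault_eq_holds`, `IsOfType.dolbeaultBar_eq_holds` (`DolbeaultProofs`) — so this
file feeds them in and records the resulting reductions to the **single** remaining named fact,
Cartan–Serre finiteness (H. Cartan, J.-P. Serre, C. R. Acad. Sci. Paris 237 (1953); Voisin
(2002), Cor. 5.25), the one analytic input not formalised in the tree: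

* `finite_and_finrank_complexDeRham_le_sum_hodgeNumber_of_finite`: for a compact Hausdorff complex
  manifold with finite-dimensional Dolbeault groups, `H^k_dR(M; ℂ)` is finite-dimensional and
  `dim_ℂ H^k_dR(M; ℂ) ≤ ∑_{p+q=k} h^{p,q}(M)`;
* `finrank_complexDeRham_le_sum_hodgeNumber_of_finite`:
  `finite_dolbeaultCohomology → finrank_complexDeRham_le_sum_hodgeNumber E M` — feeding a future
  `finite_dolbeaultCohomology_holds` to it discharges the named fact;
* `bettiNumber_le_sum_hodgeNumber_of_finite_of_exists_complexDeRhamIsoFamily`: the Frölicher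
  inequality `b_k ≤ ∑ h^{p,q}` (hodge.S18) from Cartan–Serre and de Rham's theorem in its
  canonical tree form `exists_complexDeRhamIsoFamily E`.

An independent formalisation of the same reduction (Hodge filtration on forms, leading-component
classes and the abstract first-page rank inequality
`Literature.LinearAlgebra.Filtration.finrank_cyclesQuot_le_sum_finrank`) reached the same
end-point; only the tree's `BigradedTriple` route is used here, to avoid two parallel developments.

## References

* C. Voisin, *Hodge Theory and Complex Algebraic Geometry I* (2002), §8.3.3, proof of Thm. 8.28
  and Rem. 8.29, pp. 204–205; Cor. 5.25 (`VoisinHodgeI2002`).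
* A. Frölicher, Proc. Nat. Acad. Sci. USA 41 (1955), 641–644, §2 (`FrolicherPNAS1955`).
* H. Cartan, J.-P. Serre, *Un théorème de finitude concernant les variétés analytiques
  compactes*, C. R. Acad. Sci. Paris 237 (1953), 128–130.
-/

noncomputable section

open scoped Manifold ContDiff
open Module Finset
open Literature.Geometry.Kaehler Literature.NumberTheory.Transcendental

namespace Literature.AlgebraicGeometry.Motives

section Degreewise

variable {E : Type*} [NormedAddCommGroup E] [NormedSpace ℂ E]
  {M : Type*} [TopologicalSpace M] [ChartedSpace E M]

/-- **`H^k_dR(M; ℂ)` is finite-dimensional with `dim_ℂ H^k_dR(M; ℂ) ≤ ∑_{p+q=k} h^{p,q}(M)`** for a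
compact Hausdorff complex manifold whose Dolbeault groups are finite-dimensional (Cartan–Serre,
the hypothesis `hCS`): `finite_and_finrank_complexDeRham_le_sum_hodgeNumber` of
`DeRhamComparisonFrolicherProofs` with its nine type-calculus hypotheses discharged.
Voisin (2002), §8.3.3, proof of Thm. 8.28 and Rem. 8.29, pp. 204–205; Frölicher (1955), §2.
[cite: VoisinHodgeI2002, §8.3.3, proof of Thm. 8.28 and Rem. 8.29] -/
theorem finite_and_finrank_complexDeRham_le_sum_hodgeNumber_of_finite [FiniteDimensional ℂ E]
    [IsManifold 𝓘(ℂ, E) ω M] [IsManifold 𝓘(ℝ, E) ∞ M] [CompactSpace M] [T2Space M]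
    (hCS : finite_dolbeaultCohomology (E := E) (M := M)) (k : ℕ) :
    FiniteDimensional ℂ (complexDeRhamCohomology E M k) ∧
      finrank ℂ (complexDeRhamCohomology E M k) ≤
        ∑ pq ∈ antidiagonal k, hodgeNumber E M pq.1 pq.2 := by
  exact finite_and_finrank_complexDeRham_le_sum_hodgeNumber (inChart_mextDeriv_holds 𝓘(ℝ, E) M ℂ)
    mextDeriv_smul_complex_holds isSmoothForm_typeComponent_holds
    sum_antidiagonal_typeComponent_holds typeComponent_typeComponent_holds
    isOfType_iff_typeComponent_eq_self_holds mextDeriv_eq_dolbeault_add_dolbeaultBar_holds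
    IsOfType.dolbeault_eq_holds IsOfType.dolbeaultBar_eq_holds hCS k

end Degreewise

section Facts

variable (E : Type) [NormedAddCommGroup E] [NormedSpace ℂ E]
  (M : Type) [TopologicalSpace M] [ChartedSpace E M]
  [IsManifold 𝓘(ℂ, E) ω M] [IsManifold 𝓘(ℝ, E) ∞ M]

/-- **The analytic core of the Frölicher inequality from Cartan–Serre finiteness alone**:
`finite_dolbeaultCohomology → finrank_complexDeRham_le_sum_hodgeNumber E M`
(`dim_ℂ H^k_dR(M; ℂ) ≤ ∑_{p+q=k} h^{p,q}(M)` for compact Hausdorff complex `M`), i.e.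
`finrank_complexDeRham_le_sum_hodgeNumber_of` of `DeRhamComparisonFrolicherProofs` fed with the
nine discharged type-calculus facts. Feeding a future `finite_dolbeaultCohomology_holds` to this
theorem discharges the named fact. Voisin (2002), §8.3.3, proof of Thm. 8.28 and Rem. 8.29,
pp. 204–205. [cite: VoisinHodgeI2002, §8.3.3, proof of Thm. 8.28 and Rem. 8.29] -/
theorem finrank_complexDeRham_le_sum_hodgeNumber_of_finite
    (hCS : finite_dolbeaultCohomology (E := E) (M := M)) :
    finrank_complexDeRham_le_sum_hodgeNumber E M := by
  -- tactic mode on purpose: a term-mode proof would implicit-lambda the fact's own instance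
  -- binders into the local context next to the section instances (overlapping instances)
  intro _ _ _ _ _ k
  exact finrank_complexDeRham_le_sum_hodgeNumber_of E M (inChart_mextDeriv_holds 𝓘(ℝ, E) M ℂ)
    mextDeriv_smul_complex_holds isSmoothForm_typeComponent_holds
    sum_antidiagonal_typeComponent_holds typeComponent_typeComponent_holds
    isOfType_iff_typeComponent_eq_self_holds mextDeriv_eq_dolbeault_add_dolbeaultBar_holds
    IsOfType.dolbeault_eq_holds IsOfType.dolbeaultBar_eq_holds hCS k

/-- **The Frölicher inequality `b_k(M; ℂ) ≤ ∑_{p+q=k} h^{p,q}(M)`** (hodge.S18,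
`bettiNumber_le_sum_hodgeNumber E M`) for a compact complex manifold, from the two remaining named
facts: Cartan–Serre finiteness and de Rham's theorem in its canonical tree form
`exists_complexDeRhamIsoFamily E` (`H^k_dR(M; ℂ) ≃ₗ[ℂ] H^k(M; ℂ)`), the nine type-calculus facts
being discharged. Voisin (2002), §8.3.3, Rem. 8.29; Frölicher (1955), §2.
[cite: VoisinHodgeI2002, §8.3.3, proof of Thm. 8.28 and Rem. 8.29] -/
theorem bettiNumber_le_sum_hodgeNumber_of_finite_of_exists_complexDeRhamIsoFamily
    (hCS : finite_dolbeaultCohomology (E := E) (M := M)) [FiniteDimensional ℂ E]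
    (hdR : exists_complexDeRhamIsoFamily E) :
    bettiNumber_le_sum_hodgeNumber E M := by
  intro _ _ _ _ _ k
  exact bettiNumber_le_sum_hodgeNumber_of_exists_complexDeRhamIsoFamily E M
    (finrank_complexDeRham_le_sum_hodgeNumber_of_finite E M hCS) hdR k

end Facts

end Literature.AlgebraicGeometry.Motives
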